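import Summits.BirchSwinnertonDyer.BirchSwinnertonDyer.Theorems.GenusKolyvaginAtTwoShaCardDvdPowAtTwoRTRankQ
import Summits.BirchSwinnertonDyer.BirchSwinnertonDyer.Theorems.GenusKolyvaginAtTwoGenusPrimitiveSupplyAtTwoArchimedeanUnramifiedRowsHold
import HarnessLib

/-!
# Route `GenusKolyvaginAtTwo`, crux U⁺_T `ShaCardDvdPowAtTwoPosT` (stmt-BirchSwinnertonDyer-23378, `Δ > 0`): (RANKQ⁺) —
# `#Sel₂(E/ℚ) ∣ 4` and `#Ш(E/ℚ)[2] ∣ 4` from a TAMAGAWA-ODD `2`-Selmer-minimal Heegner twin on `Δ_E > 0`, UNCONDITIONALLY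
# (Mazur–Rubin Cor. 3.4 (i) with the single `T`-place `∞`)

Seat `bsd-line-gk2-p3` g27 (PROVER seat 3/3, cell `bsd-f1-sign2`), `--supports stmt-BirchSwinnertonDyer-23378` (helper; closes nothing).
THEOREMS ONLY (no definition, no named fact, no `sorry`); standard axioms.  BSD is NOT proved by any of this; U⁺_T / Q4_T are NOT proved.

WHY.  LINE 19's (RANKQ) (gk2-p3 g26, `…RTRankQ`: `#Sel₂(E) ∣ 4` from a Sel₂-minimal twin with `ord₂ C(Wd) ≤ 1`) is typed on `Δ_E < 0`, where
the real place carries no `2`-Selmer condition and the one `T`-place of Mazur–Rubin's comparison is the TRANSPOSITION prime of `d_K`.  On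
`Δ_E > 0` the genus parity flips: for a prime `|d_K|` the ramified prime is SILENT or totally split, never a transposition, and the real place
`∞` (ramified in the imaginary `K`, `w(Δ_E) > 0`) IS a `T`-place.  So the `Δ > 0` live configuration is the TAMAGAWA-ODD twin
(`ord₂ C(Wd) = 0` ⟺ every prime of `d_K` silent, `C(W)` odd), and Mazur–Rubin Cor. 3.4 (i) with `T = {∞}` — the tree's UNCONDITIONAL kernel theorem
`GenusKolyArch.natCard_selmerGroup_twist_shift_of_menu₅_inl` (gk2-p5 g12 / gk2-p4 g12, five-row finite menu, real `T`-place) — gives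
`#Sel₂(Wd)·2 = #Sel₂(W)` or `#Sel₂(Wd) = #Sel₂(W)·2`, i.e. `#Sel₂(W) ∈ {1, 4}` when `#Sel₂(Wd) = 2`.

* §1 `forall_twoTorsion_padic_eq_zero_of_padicValNat_two_tamagawaProduct_twin_eq_zero` — `ord₂ C(Wd) = 0` ⟹ EVERY prime of `d_K` is silent
  for `W` (`W(ℚ_q)[2] = 0`): the `T`-extraction of gk2-p5 g20 (`…HabitatCutReach`) at budget `0`.
* §2 `twist_place_menu₅_finite_rat_of_all_silent` — then EVERY finite place of `ℚ` is on the five-row menu (g26's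
  `twist_place_menu₅_finite_rat_of_silent`, the excluded place `v₀` chosen away from `v`).
* §3 **`natCard_selmerGroup_two_dvd_four_of_posDisc_of_padicValNat_eq_zero`** — `W/ℚ` globally minimal elliptic with `Δ_W > 0` and `C(W)` odd,
  `K` imaginary quadratic with odd `d_K`, Heegner for `N_W`, `Wd ≅ W^(d_K)` elliptic with `ord₂ C(Wd) = 0` and `#Sel₂(Wd) = 2` ⟹ **`#Sel₂(W) ∣ 4`**;
  **`natCard_sha_torsionBy_two_dvd_four_of_posDisc_of_padicValNat_eq_zero`** — **`#Ш(W/ℚ)[2] ∣ 4`** (RANKQ⁺: the `2`-rank input of the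
  `Δ > 0` on-cut upper half, sequel file `…PosTOnCut`).

HONEST FRAMING: an instantiation over `ℚ` of tree theorems (Kramer 1981 / Mazur–Rubin 2010 at `T = {∞}`); beyond print: no.  BSD is NOT proved.

References: [MazurRubin2010] Thm. 2.7, Lemmas 2.9–2.10, Prop. 3.3, Cor. 3.4 (i); [Kramer1981] §2 Props. 3, 6, Thm. 1; [MilneADT2006] I Thm. 4.10;
[SilvermanAEC2009] VII Prop. 3.1 (b), X Thm. 4.2.
-/

set_option linter.dupNamespace false -- tree convention: `Summit.BirchSwinnertonDyer.BirchSwinnertonDyer.Theorems` (summit = sub-problem)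
set_option autoImplicit false

noncomputable section

open scoped Classical ContRepresentation

namespace Summit.BirchSwinnertonDyer.BirchSwinnertonDyer.Theorems.GenusExact.PlusDescent

open WeierstrassCurve Field NumberField IsDedekindDomain Function
open Literature.NumberTheory.EllipticCurves Literature.NumberTheory.GaloisRepresentations
open Literature.NumberTheory.GaloisRepresentations.IsNonarchimedeanLocalField (maxUnramified)
open Literature.NumberTheory.GaloisCohomology
open Summit.BirchSwinnertonDyer.BirchSwinnertonDyer.Theorems.GenusKolyTwistLocal
open Summit.BirchSwinnertonDyer.BirchSwinnertonDyer.Theorems.GenusKolyArch (natCard_ker_nsmul_eq_of_intertwining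
  embedding_of_isReal_rat_apply forall_sq_ne_completion_of_neg natCard_selmerGroup_twist_shift_of_menu₅_inl)
open Rat.HeightOneSpectrum (primesEquiv natGenerator)

variable (W : WeierstrassCurve ℚ) [W.IsElliptic] [W.IsGloballyMinimal]

/-! ## §1 `ord₂ C(Wd) = 0`: every prime of `d_K` is silent -/

/-- **The `T`-extraction at budget `0`: `ord₂ C(Wd) = 0` ⟹ `W(ℚ_q)[2] = 0` at every prime `q ∣ d_K`.**  `W/ℚ` globally minimal with `C(W)`
odd, `K` imaginary quadratic with odd `d_K` and Heegner for `N_W`, `Wd = Cd • W^(d_K)`: `ord₂ C(Wd) = ord₂ C(W) + Σ_{q ∣ d_K} ord₂(1 + #roots_q)`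
(gk2-p3 g17 `padicValNat_two_tamagawaProduct_twin_eq`) and `1 + #roots_q` is a power of `2`, so a vanishing budget forces `#roots_q = 0` at every
`q ∣ d_K`.  [cite: Kramer1981, §2 Prop. 3] [cite: SilvermanAEC2009, VII.3 Prop. 3.1 (b)] -/
theorem forall_twoTorsion_padic_eq_zero_of_padicValNat_two_tamagawaProduct_twin_eq_zero
    {K : Type} [Field K] [NumberField K] (hK : IsImaginaryQuadratic K) (hodd : Odd (NumberField.discr K))
    (hH : SatisfiesHeegnerHypothesis (W.conductorNorm ℤ) K) (hTam : Odd W.tamagawaProduct)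
    {Wd : WeierstrassCurve ℚ} [Wd.IsElliptic] (Cd : VariableChange ℚ) (hWd : Cd • W.quadraticTwist (NumberField.discr K : ℚ) = Wd)
    (hB : padicValNat 2 Wd.tamagawaProduct = 0) :
    ∀ (p : ℕ) [Fact p.Prime], (p : ℤ) ∣ NumberField.discr K → ∀ Q : (W.baseChange ℚ_[p]).toAffine.Point, 2 • Q = 0 → Q = 0 := by
  haveI : Fact (Nat.Prime 2) := ⟨Nat.prime_two⟩
  set S := (NumberField.discr K).natAbs.primeFactors with hS
  set f : ℕ → ℕ := fun q ↦ padicValNat 2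
    ({x : ZMod q | 4 * x ^ 3 + ((integralModelInt W).b₂ : ZMod q) * x ^ 2 +
      2 * ((integralModelInt W).b₄ : ZMod q) * x + ((integralModelInt W).b₆ : ZMod q) = 0}.ncard + 1) with hf
  have hW0 : padicValNat 2 W.tamagawaProduct = 0 :=
    padicValNat.eq_zero_of_not_dvd fun h ↦ (Nat.not_even_iff_odd.mpr hTam) (even_iff_two_dvd.mpr h)
  have hsum : ∑ q ∈ S, f q = 0 := by
    have h := padicValNat_two_tamagawaProduct_twin_eq W hK hodd hH Cd hWd
    rw [hB, hW0, zero_add] at h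
    exact h.symm
  have hall : ∀ q ∈ S, f q = 0 := fun q hq ↦ (Finset.sum_eq_zero_iff.mp hsum) q hq
  intro p _ hpd Q hQ
  have hpP : p.Prime := Fact.out
  have hd0 : (NumberField.discr K).natAbs ≠ 0 := Int.natAbs_ne_zero.mpr (NumberField.discr_ne_zero K)
  have hpS : p ∈ S := by
    rw [hS, Nat.mem_primeFactors]
    exact ⟨hpP, Int.natCast_dvd.mp (by simpa using hpd), hd0⟩
  have hp2 : p ≠ 2 := by
    rintro rfl
    obtain ⟨r, hr⟩ := hodd
    omega
  have hpΔ : ¬ (p : ℤ) ∣ minimalDiscriminantInt W := not_dvd_minimalDiscriminantInt_of_dvd_discr_of_heegner W K hK.1 hH hpP hp2 hpd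
  -- `1 + #roots_p = 2^(f p) = 1`
  have hroots := one_add_card_roots_eq_two_pow W hp2 hpΔ
  have hncard : ({x : ZMod p | 4 * x ^ 3 + ((integralModelInt W).b₂ : ZMod p) * x ^ 2 +
      2 * ((integralModelInt W).b₄ : ZMod p) * x + ((integralModelInt W).b₆ : ZMod p) = 0} : Set (ZMod p)).ncard =
      (Finset.univ.filter fun x : ZMod p =>
        4 * x ^ 3 + ((integralModelInt W).b₂ : ZMod p) * x ^ 2 +
          2 * ((integralModelInt W).b₄ : ZMod p) * x + ((integralModelInt W).b₆ : ZMod p) = 0).card := by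
    rw [← Set.ncard_coe_finset]
    congr 1
    ext x
    simp
  have hfp : f p = 0 := hall p hpS
  have hfp' : padicValNat 2 (1 + (Finset.univ.filter fun x : ZMod p =>
        4 * x ^ 3 + ((integralModelInt W).b₂ : ZMod p) * x ^ 2 +
          2 * ((integralModelInt W).b₄ : ZMod p) * x + ((integralModelInt W).b₆ : ZMod p) = 0).card) = 0 := by
    rw [hf] at hfp
    dsimp only at hfp
    rw [hncard, add_comm] at hfp
    exact hfp
  rw [hfp', pow_zero] at hroots
  have hcard : (Finset.univ.filter fun x : ZMod p =>
      4 * x ^ 3 + ((integralModelInt W).b₂ : ZMod p) * x ^ 2 +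
        2 * ((integralModelInt W).b₄ : ZMod p) * x + ((integralModelInt W).b₆ : ZMod p) = 0).card = 0 := by omega
  refine GenusKolyTwin.twoTorsion_padic_eq_zero_of_forall_ne W hp2 hpΔ (fun x hx ↦ ?_) Q hQ
  have hmem : x ∈ (Finset.univ.filter fun x : ZMod p =>
      4 * x ^ 3 + ((integralModelInt W).b₂ : ZMod p) * x ^ 2 +
        2 * ((integralModelInt W).b₄ : ZMod p) * x + ((integralModelInt W).b₆ : ZMod p) = 0) :=
    Finset.mem_filter.mpr ⟨Finset.mem_univ x, hx⟩
  rw [Finset.card_eq_zero.mp hcard] at hmem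
  exact Finset.notMem_empty x hmem

/-! ## §2 The five-row finite menu at EVERY finite place when all primes of `d_K` are silent -/

omit [W.IsElliptic] [W.IsGloballyMinimal] in
/-- There are two distinct finite places of `ℚ`: for every `v` some `v₀ ≠ v` (the primes `2` and `3`). [folklore] -/
theorem exists_heightOneSpectrum_ne (v : HeightOneSpectrum (𝓞 ℚ)) : ∃ v₀ : HeightOneSpectrum (𝓞 ℚ), v ≠ v₀ := by
  have hex : ∃ q : Nat.Primes, q ≠ primesEquiv v := by
    by_cases h2 : ((primesEquiv v : Nat.Primes) : ℕ) = 2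
    · refine ⟨⟨3, Nat.prime_three⟩, fun h ↦ ?_⟩
      have h' := congrArg (fun q : Nat.Primes ↦ (q : ℕ)) h
      simp only [h2] at h'
      omega
    · exact ⟨⟨2, Nat.prime_two⟩, fun h ↦ h2 (by rw [← h])⟩
  obtain ⟨q, hq⟩ := hex
  refine ⟨primesEquiv.symm q, fun h ↦ hq ?_⟩
  rw [h, Equiv.apply_symm_apply]

/-- **The five-row finite menu at every finite place of `ℚ`** for a Heegner twin all of whose ramified primes are silent: `[K:ℚ] = 2`, `d_K` odd,
Heegner for `N_W`, `Wd = C • W^(d_K)`, and `#W(ℚ_q)[2] = #Wd(ℚ_q)[2] = 1` at every `q ∣ d_K`.  (gk2-p3 g26's `twist_place_menu₅_finite_rat_of_silent`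
with the excluded place chosen away from the given one.)  [cite: MazurRubin2010, Lemma 2.10] [cite: Kramer1981, §2 Prop. 3] -/
theorem twist_place_menu₅_finite_rat_of_all_silent {K : Type} [Field K] [NumberField K]
    (h2 : Module.finrank ℚ K = 2) (hodd : Odd (discr K)) (hH : SatisfiesHeegnerHypothesis (W.conductorNorm ℤ) K)
    {Wd : WeierstrassCurve ℚ} {C : VariableChange ℚ} (hC : C • W.quadraticTwist (discr K : ℚ) = Wd)
    (hsil : ∀ v : HeightOneSpectrum (𝓞 ℚ), (((primesEquiv v : Nat.Primes) : ℕ) : ℤ) ∣ discr K →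
      Nat.card (nsmulAddMonoidHom 2 : (W.baseChange (v.adicCompletion ℚ)).toAffine.Point →+ _).ker = 1 ∧
      Nat.card (nsmulAddMonoidHom 2 : (Wd.baseChange (v.adicCompletion ℚ)).toAffine.Point →+ _).ker = 1) :
    ∀ v : HeightOneSpectrum (𝓞 ℚ),
      (∃ s : v.adicCompletion ℚ, s ^ 2 = algebraMap ℚ (v.adicCompletion ℚ) (discr K : ℚ)) ∨
      (((2 : ℕ) : 𝓞 ℚ) ∉ v.asIdeal ∧
        ¬ 2 ∣ (W.baseChange (v.adicCompletion ℚ)).localTamagawaNumber (v.adicCompletionIntegers ℚ) ∧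
        ¬ 2 ∣ (Wd.baseChange (v.adicCompletion ℚ)).localTamagawaNumber (v.adicCompletionIntegers ℚ)) ∨
      (((2 : ℕ) : 𝓞 ℚ) ∉ v.asIdeal ∧ W.HasGoodReductionAt v ∧ Wd.HasGoodReductionAt v) ∨
      (((2 : ℕ) : 𝓞 ℚ) ∉ v.asIdeal ∧
        Nat.card (nsmulAddMonoidHom 2 : (W.baseChange (v.adicCompletion ℚ)).toAffine.Point →+ _).ker = 1 ∧
        Nat.card (nsmulAddMonoidHom 2 : (Wd.baseChange (v.adicCompletion ℚ)).toAffine.Point →+ _).ker = 1) ∨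
      ((W.HasGoodReductionAt v ∨ (W.HasMultiplicativeReductionAt v ∧ Odd (W.ordMinimalDiscriminant v))) ∧
        closureEmb (K := ℚ) (v.adicCompletion ℚ) (geomSqrt (discr K : ℚ)) ∈ maxUnramified (v.adicCompletion ℚ)) := by
  intro v
  obtain ⟨v₀, hv₀⟩ := exists_heightOneSpectrum_ne v
  exact twist_place_menu₅_finite_rat_of_silent W h2 hodd hH v₀ hC (fun v' _ hdvd ↦ hsil v' hdvd) v hv₀

/-! ## §3 (RANKQ⁺): `#Sel₂(E/ℚ) ∣ 4` and `#Ш(E/ℚ)[2] ∣ 4` on `Δ > 0` from a Tamagawa-odd `2`-Selmer-minimal twin -/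

/-- **(RANKQ⁺) on `Δ > 0`: `#Sel₂(W) ∣ 4`, UNCONDITIONALLY.**  `W/ℚ` globally minimal elliptic with `Δ_W > 0` and `C(W)` odd; `K` imaginary
quadratic with odd `d_K`, Heegner for `N_W`; `Wd ≅ W^(d_K)` elliptic with `ord₂ C(Wd) = 0` (⟺ every prime of `d_K` silent) and `#Sel₂(Wd) = 2`.
Then `#Sel₂(W) ∣ 4` — Mazur–Rubin Cor. 3.4 (i) with the single `T`-place `∞` (`GenusKolyArch.natCard_selmerGroup_twist_shift_of_menu₅_inl`):
`#Sel₂(Wd)·2 = #Sel₂(W)` or `#Sel₂(Wd) = #Sel₂(W)·2`.  The `Δ > 0` twin of g26's `natCard_selmerGroup_two_dvd_four_of_genusBudget_le_one_unramified`.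
[cite: MazurRubin2010, Thm. 2.7, Lemmas 2.9–2.10, Prop. 3.3, Cor. 3.4 (i)] [cite: Kramer1981, §2 Props. 3, 6, Thm. 1] [cite: MilneADT2006, I Thm. 4.10] -/
theorem natCard_selmerGroup_two_dvd_four_of_posDisc_of_padicValNat_eq_zero {K : Type} [Field K] [NumberField K]
    (hΔ : 0 < W.Δ) (hTam : Odd W.tamagawaProduct) (hK : IsImaginaryQuadratic K) (hodd : Odd (discr K))
    (hH : SatisfiesHeegnerHypothesis (W.conductorNorm ℤ) K)
    (Wd : WeierstrassCurve ℚ) [Wd.IsElliptic] (hWd : ∃ C : VariableChange ℚ, C • W.quadraticTwist (discr K : ℚ) = Wd)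
    (hDEF : padicValNat 2 Wd.tamagawaProduct = 0) (hSel : Nat.card (Wd.selmerGroup 2) = 2) :
    Nat.card (W.selmerGroup 2) ∣ 4 := by
  obtain ⟨Cd, hCd⟩ := hWd
  have hdneg : discr K < 0 := IsImaginaryQuadratic.discr_neg hK
  have hd0 : (discr K : ℚ) ≠ 0 := by exact_mod_cast hdneg.ne
  -- every prime of `d_K` is silent for `W`, hence for `Wd`
  have hsilQ := forall_twoTorsion_padic_eq_zero_of_padicValNat_two_tamagawaProduct_twin_eq_zero W hK hodd hH hTam Cd hCd hDEF
  obtain ⟨φ, ψ, hψφ, hφψ, -⟩ := exists_intertwining_master_frame W Wd hd0 hCd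
  have hsil : ∀ v : HeightOneSpectrum (𝓞 ℚ), (((primesEquiv v : Nat.Primes) : ℕ) : ℤ) ∣ discr K →
      Nat.card (nsmulAddMonoidHom 2 : (W.baseChange (v.adicCompletion ℚ)).toAffine.Point →+ _).ker = 1 ∧
      Nat.card (nsmulAddMonoidHom 2 : (Wd.baseChange (v.adicCompletion ℚ)).toAffine.Point →+ _).ker = 1 := by
    intro v hvd
    haveI := Fact.mk (primesEquiv v).2
    have hker : Nat.card (nsmulAddMonoidHom 2 : (W.baseChange (v.adicCompletion ℚ)).toAffine.Point →+ _).ker = 1 := by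
      rw [natCard_ker_nsmul_adicCompletion_eq_padic W v 2]
      have h0 := hsilQ ((primesEquiv v : Nat.Primes) : ℕ) hvd
      rw [Nat.card_eq_one_iff_unique]
      refine ⟨⟨fun a b ↦ Subtype.ext ((h0 a.1 a.2).trans (h0 b.1 b.2).symm)⟩, ⟨⟨0, by simp⟩⟩⟩
    refine ⟨hker, ?_⟩
    -- the `CharZero` / `Algebra` instances are passed explicitly so that the `ℚ`-algebra structure of `ℚ_v` stays the `adicCompletion` one
    rw [@natCard_ker_nsmul_eq_of_intertwining ℚ _ _ W Wd _ _ 2 two_ne_zero φ ψ hψφ hφψ (v.adicCompletion ℚ) _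
      (HeightOneSpectrum.instAlgebraAdicCompletion (𝓞 ℚ) ℚ v) (charZero_adicCompletion v)]
    exact hker
  -- the menus
  have hfin := twist_place_menu₅_finite_rat_of_all_silent W hK.1 hodd hH hCd hsil
  have hw₀ : (Rat.infinitePlace).IsReal := Rat.isReal_infinitePlace
  have hΔ' : 0 < InfinitePlace.embedding_of_isReal hw₀ W.Δ := by rwa [embedding_of_isReal_rat_apply, Rat.cast_pos]
  have hinf : ∀ w : InfinitePlace ℚ, w ≠ Rat.infinitePlace →
      (∃ s : w.Completion, s ^ 2 = algebraMap ℚ w.Completion (discr K : ℚ)) ∨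
      ((∀ x : galoisCohomology (W.localGaloisModule w.Completion) 1, x = 0) ∧
        (∀ x : galoisCohomology (Wd.localGaloisModule w.Completion) 1, x = 0)) :=
    fun w hw ↦ absurd (Subsingleton.elim w _) hw
  have hdsq₀ := forall_sq_ne_completion_of_neg (show (discr K : ℚ) < 0 by exact_mod_cast hdneg) Rat.infinitePlace
  have h := natCard_selmerGroup_twist_shift_of_menu₅_inl W hd0 hCd hw₀ hΔ' hdsq₀ hfin hinf
  simp only [Nat.cast_ofNat] at h
  rw [hSel] at h
  rcases h with h | h
  · exact ⟨1, by omega⟩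
  · exact ⟨4, by omega⟩

/-- **(RANKQ⁺), `Ш`-form: `#Ш(W/ℚ)[2] ∣ 4` on `Δ > 0`**, UNCONDITIONALLY (`#Ш[2] ∣ #Sel₂ ∣ 4`, g26's `natCard_sha_torsionBy_dvd_natCard_selmerGroup`):
the `2`-rank input of the `Δ > 0` on-cut upper half (with the `ℚ`-side sharp exponent and the sign-free pair sandwich).
[cite: MazurRubin2010, Cor. 3.4 (i)] [cite: SilvermanAEC2009, Thm. X.4.2] -/
theorem natCard_sha_torsionBy_two_dvd_four_of_posDisc_of_padicValNat_eq_zero {K : Type} [Field K] [NumberField K]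
    (hΔ : 0 < W.Δ) (hTam : Odd W.tamagawaProduct) (hK : IsImaginaryQuadratic K) (hodd : Odd (discr K))
    (hH : SatisfiesHeegnerHypothesis (W.conductorNorm ℤ) K)
    (Wd : WeierstrassCurve ℚ) [Wd.IsElliptic] (hWd : ∃ C : VariableChange ℚ, C • W.quadraticTwist (discr K : ℚ) = Wd)
    (hDEF : padicValNat 2 Wd.tamagawaProduct = 0) (hSel : Nat.card (Wd.selmerGroup 2) = 2) :
    Nat.card (AddSubgroup.torsionBy W.sha (2 : ℤ)) ∣ 4 := by
  have hsha := natCard_sha_torsionBy_dvd_natCard_selmerGroup W (n := 2) two_ne_zero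
  simp only [Nat.cast_ofNat] at hsha
  exact hsha.trans (natCard_selmerGroup_two_dvd_four_of_posDisc_of_padicValNat_eq_zero W hΔ hTam hK hodd hH Wd hWd hDEF hSel)

/-! ## §4 Supply⁺ side (appended 2026-08-30, same seat): the converse budget and the Mazur–Rubin step of the all-silent twisting is FREE

For the `Δ > 0` supply crux (LEAD gk2-p1 g20's R9, stub A⁺ «for `#Sel₂(E) = 1` EVERY Heegner `d` all of whose primes are silent gives `#Sel₂(E^(d)) = 2`»):
the dichotomy of §3 read in the other direction.  With every prime of `d_K` silent: `ord₂ C(Wd) = 0` (converse of §1), and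
`#Sel₂(Wd)·2 = #Sel₂(W) ∨ #Sel₂(Wd) = #Sel₂(W)·2`; so `#Sel₂(W) = 1 ⟹ #Sel₂(Wd) = 2` for EVERY such twin (no Čebotarev choice needed on the
Selmer side — only `r_an(E^(d)) = 1` remains for the supply), and `#Sel₂(W) = 4 ⟹ #Sel₂(Wd) ∈ {2, 8}`. -/

/-- **Converse of §1: every prime of `d_K` silent ⟹ `ord₂ C(Wd) = 0`.**  `W/ℚ` globally minimal with `C(W)` odd, `K` imaginary quadratic with odd
`d_K`, Heegner for `N_W`, `Wd = Cd • W^(d_K)`; if `W(ℚ_q)[2] = 0` at every prime `q ∣ d_K` then `ord₂ C(Wd) = 0`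
(`ord₂ C(Wd) = ord₂ C(W) + Σ_{q ∣ d_K} ord₂(#roots_q + 1)` and `#W(ℚ_q)[2] = #roots_q + 1 = 1`).
[cite: Kramer1981, §2 Prop. 3] [cite: SilvermanAEC2009, VII.3 Prop. 3.1 (b)] [cite: MazurRubin2010, Lemma 2.2 (i)] -/
theorem padicValNat_two_tamagawaProduct_twin_eq_zero_of_forall_silent
    {K : Type} [Field K] [NumberField K] (hK : IsImaginaryQuadratic K) (hodd : Odd (NumberField.discr K))
    (hH : SatisfiesHeegnerHypothesis (W.conductorNorm ℤ) K) (hTam : Odd W.tamagawaProduct)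
    {Wd : WeierstrassCurve ℚ} [Wd.IsElliptic] (Cd : VariableChange ℚ) (hWd : Cd • W.quadraticTwist (NumberField.discr K : ℚ) = Wd)
    (hsil : ∀ (p : ℕ) [Fact p.Prime], (p : ℤ) ∣ NumberField.discr K → ∀ Q : (W.baseChange ℚ_[p]).toAffine.Point, 2 • Q = 0 → Q = 0) :
    padicValNat 2 Wd.tamagawaProduct = 0 := by
  haveI : Fact (Nat.Prime 2) := ⟨Nat.prime_two⟩
  have hW0 : padicValNat 2 W.tamagawaProduct = 0 :=
    padicValNat.eq_zero_of_not_dvd fun h ↦ (Nat.not_even_iff_odd.mpr hTam) (even_iff_two_dvd.mpr h)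
  rw [padicValNat_two_tamagawaProduct_twin_eq W hK hodd hH Cd hWd, hW0, zero_add]
  refine Finset.sum_eq_zero fun q hq ↦ ?_
  have hqP : q.Prime := Nat.prime_of_mem_primeFactors hq
  haveI : Fact q.Prime := ⟨hqP⟩
  have hqd : (q : ℤ) ∣ NumberField.discr K := Int.natCast_dvd.mpr (Nat.dvd_of_mem_primeFactors hq)
  have hq2 : q ≠ 2 := by
    rintro rfl
    obtain ⟨r, hr⟩ := hodd
    omega
  have hqΔ : ¬ (q : ℤ) ∣ minimalDiscriminantInt W := not_dvd_minimalDiscriminantInt_of_dvd_discr_of_heegner W K hK.1 hH hqP hq2 hqd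
  have hcard := GenusKolyTwin.natCard_twoTorsion_padic_eq W hq2 hqΔ
  have h1 : Nat.card {Q : (W.baseChange ℚ_[q]).toAffine.Point // 2 • Q = 0} = 1 :=
    Nat.card_eq_one_iff_unique.mpr
      ⟨⟨fun a b ↦ Subtype.ext ((hsil q hqd a.1 a.2).trans (hsil q hqd b.1 b.2).symm)⟩, ⟨⟨0, by simp⟩⟩⟩
  have h0 : ({x : ZMod q | 4 * x ^ 3 + ((integralModelInt W).b₂ : ZMod q) * x ^ 2 +
      2 * ((integralModelInt W).b₄ : ZMod q) * x + ((integralModelInt W).b₆ : ZMod q) = 0} : Set (ZMod q)).ncard = 0 := by omega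
  rw [h0, zero_add, padicValNat_one_right]

/-- **The Mazur–Rubin dichotomy on `Δ > 0` for an all-silent Heegner twin, UNCONDITIONALLY**: `W/ℚ` globally minimal elliptic with `Δ_W > 0` and
`C(W)` odd; `K` imaginary quadratic with odd `d_K`, Heegner for `N_W`; `Wd ≅ W^(d_K)` elliptic with `ord₂ C(Wd) = 0`.  Then
`#Sel₂(Wd)·2 = #Sel₂(W) ∨ #Sel₂(Wd) = #Sel₂(W)·2` (Cor. 3.4 (i) with the single `T`-place `∞`; §3 is the case `#Sel₂(Wd) = 2`).
[cite: MazurRubin2010, Thm. 2.7, Lemmas 2.9–2.10, Prop. 3.3, Cor. 3.4 (i)] [cite: Kramer1981, §2 Props. 3, 6, Thm. 1] -/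
theorem natCard_selmerGroup_twin_shift_of_posDisc_of_padicValNat_eq_zero {K : Type} [Field K] [NumberField K]
    (hΔ : 0 < W.Δ) (hTam : Odd W.tamagawaProduct) (hK : IsImaginaryQuadratic K) (hodd : Odd (discr K))
    (hH : SatisfiesHeegnerHypothesis (W.conductorNorm ℤ) K)
    (Wd : WeierstrassCurve ℚ) [Wd.IsElliptic] (hWd : ∃ C : VariableChange ℚ, C • W.quadraticTwist (discr K : ℚ) = Wd)
    (hDEF : padicValNat 2 Wd.tamagawaProduct = 0) :
    Nat.card (Wd.selmerGroup 2) * 2 = Nat.card (W.selmerGroup 2) ∨ Nat.card (Wd.selmerGroup 2) = Nat.card (W.selmerGroup 2) * 2 := by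
  obtain ⟨Cd, hCd⟩ := hWd
  have hdneg : discr K < 0 := IsImaginaryQuadratic.discr_neg hK
  have hd0 : (discr K : ℚ) ≠ 0 := by exact_mod_cast hdneg.ne
  have hsilQ := forall_twoTorsion_padic_eq_zero_of_padicValNat_two_tamagawaProduct_twin_eq_zero W hK hodd hH hTam Cd hCd hDEF
  obtain ⟨φ, ψ, hψφ, hφψ, -⟩ := exists_intertwining_master_frame W Wd hd0 hCd
  have hsil : ∀ v : HeightOneSpectrum (𝓞 ℚ), (((primesEquiv v : Nat.Primes) : ℕ) : ℤ) ∣ discr K →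
      Nat.card (nsmulAddMonoidHom 2 : (W.baseChange (v.adicCompletion ℚ)).toAffine.Point →+ _).ker = 1 ∧
      Nat.card (nsmulAddMonoidHom 2 : (Wd.baseChange (v.adicCompletion ℚ)).toAffine.Point →+ _).ker = 1 := by
    intro v hvd
    haveI := Fact.mk (primesEquiv v).2
    have hker : Nat.card (nsmulAddMonoidHom 2 : (W.baseChange (v.adicCompletion ℚ)).toAffine.Point →+ _).ker = 1 := by
      rw [natCard_ker_nsmul_adicCompletion_eq_padic W v 2]
      have h0 := hsilQ ((primesEquiv v : Nat.Primes) : ℕ) hvd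
      rw [Nat.card_eq_one_iff_unique]
      refine ⟨⟨fun a b ↦ Subtype.ext ((h0 a.1 a.2).trans (h0 b.1 b.2).symm)⟩, ⟨⟨0, by simp⟩⟩⟩
    refine ⟨hker, ?_⟩
    rw [@natCard_ker_nsmul_eq_of_intertwining ℚ _ _ W Wd _ _ 2 two_ne_zero φ ψ hψφ hφψ (v.adicCompletion ℚ) _
      (HeightOneSpectrum.instAlgebraAdicCompletion (𝓞 ℚ) ℚ v) (charZero_adicCompletion v)]
    exact hker
  have hfin := twist_place_menu₅_finite_rat_of_all_silent W hK.1 hodd hH hCd hsil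
  have hw₀ : (Rat.infinitePlace).IsReal := Rat.isReal_infinitePlace
  have hΔ' : 0 < InfinitePlace.embedding_of_isReal hw₀ W.Δ := by rwa [embedding_of_isReal_rat_apply, Rat.cast_pos]
  have hinf : ∀ w : InfinitePlace ℚ, w ≠ Rat.infinitePlace →
      (∃ s : w.Completion, s ^ 2 = algebraMap ℚ w.Completion (discr K : ℚ)) ∨
      ((∀ x : galoisCohomology (W.localGaloisModule w.Completion) 1, x = 0) ∧
        (∀ x : galoisCohomology (Wd.localGaloisModule w.Completion) 1, x = 0)) :=
    fun w hw ↦ absurd (Subsingleton.elim w _) hw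
  have hdsq₀ := forall_sq_ne_completion_of_neg (show (discr K : ℚ) < 0 by exact_mod_cast hdneg) Rat.infinitePlace
  have h := natCard_selmerGroup_twist_shift_of_menu₅_inl W hd0 hCd hw₀ hΔ' hdsq₀ hfin hinf
  simpa only [Nat.cast_ofNat] using h

/-- **Supply⁺, the Mazur–Rubin step is FREE: `#Sel₂(W) = 1 ⟹ #Sel₂(Wd) = 2` for EVERY all-silent Heegner twin on `Δ > 0`.**  `W/ℚ` globally minimal
elliptic with `Δ_W > 0`, `C(W)` odd and `#Sel₂(W) = 1`; `K` imaginary quadratic with odd `d_K`, Heegner for `N_W`, EVERY prime of `d_K` silent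
(`W(ℚ_q)[2] = 0`); `Wd ≅ W^(d_K)` elliptic.  Then `ord₂ C(Wd) = 0` AND `#Sel₂(Wd) = 2` — the twin is Tamagawa-odd and `2`-Selmer-minimal with no further
choice (LEAD R9 §1: stub A⁺ reduces to «∃ all-silent Heegner `d` with `r_an(E^(d)) = 1»`).  [cite: MazurRubin2010, Cor. 3.4 (i)] [cite: Kramer1981, Thm. 1] -/
theorem natCard_selmerGroup_twin_eq_two_of_natCard_eq_one_of_forall_silent {K : Type} [Field K] [NumberField K]
    (hΔ : 0 < W.Δ) (hTam : Odd W.tamagawaProduct) (hSelW : Nat.card (W.selmerGroup 2) = 1)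
    (hK : IsImaginaryQuadratic K) (hodd : Odd (discr K)) (hH : SatisfiesHeegnerHypothesis (W.conductorNorm ℤ) K)
    (hsil : ∀ (p : ℕ) [Fact p.Prime], (p : ℤ) ∣ discr K → ∀ Q : (W.baseChange ℚ_[p]).toAffine.Point, 2 • Q = 0 → Q = 0)
    (Wd : WeierstrassCurve ℚ) [Wd.IsElliptic] (hWd : ∃ C : VariableChange ℚ, C • W.quadraticTwist (discr K : ℚ) = Wd) :
    padicValNat 2 Wd.tamagawaProduct = 0 ∧ Nat.card (Wd.selmerGroup 2) = 2 := by
  obtain ⟨Cd, hCd⟩ := hWd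
  have hDEF := padicValNat_two_tamagawaProduct_twin_eq_zero_of_forall_silent W hK hodd hH hTam Cd hCd hsil
  refine ⟨hDEF, ?_⟩
  have h := natCard_selmerGroup_twin_shift_of_posDisc_of_padicValNat_eq_zero W hΔ hTam hK hodd hH Wd ⟨Cd, hCd⟩ hDEF
  rw [hSelW] at h
  omega

/-- **`#Sel₂(W) = 4 ⟹ #Sel₂(Wd) ∈ {2, 8}`** for an all-silent (`ord₂ C(Wd) = 0`) Heegner twin on `Δ > 0` (the `2`-Selmer-minimal case `= 2` is the one
the upper half U⁺_T′ consumes; which case occurs is decided by whether `Sel₂(W)` is strict at `∞`, Mazur–Rubin Prop. 3.3).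
[cite: MazurRubin2010, Prop. 3.3, Cor. 3.4 (i)] -/
theorem natCard_selmerGroup_twin_eq_two_or_eq_eight_of_natCard_eq_four {K : Type} [Field K] [NumberField K]
    (hΔ : 0 < W.Δ) (hTam : Odd W.tamagawaProduct) (hSelW : Nat.card (W.selmerGroup 2) = 4)
    (hK : IsImaginaryQuadratic K) (hodd : Odd (discr K)) (hH : SatisfiesHeegnerHypothesis (W.conductorNorm ℤ) K)
    (Wd : WeierstrassCurve ℚ) [Wd.IsElliptic] (hWd : ∃ C : VariableChange ℚ, C • W.quadraticTwist (discr K : ℚ) = Wd)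
    (hDEF : padicValNat 2 Wd.tamagawaProduct = 0) :
    Nat.card (Wd.selmerGroup 2) = 2 ∨ Nat.card (Wd.selmerGroup 2) = 8 := by
  have h := natCard_selmerGroup_twin_shift_of_posDisc_of_padicValNat_eq_zero W hΔ hTam hK hodd hH Wd hWd hDEF
  rw [hSelW] at h
  omega

end Summit.BirchSwinnertonDyer.BirchSwinnertonDyer.Theorems.GenusExact.PlusDescent

end
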